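import Summits.QuantumFields.YangMills.Theorems.BalabanUVNodesPortS1FHParamD
import Summits.QuantumFields.YangMills.Theorems.BalabanUVNodesPortS1FHDischarge
open Metric Set Filter Topology
open scoped ContDiff

/-!
# Bałaban UV nodes port — S₁ helper: the F_H fixed points as ANALYTIC FUNCTIONALS OF THE OPERATORS, II (`A₀` of (1.4), `H_k(s, B′)` of (1.17))

Support file for ⟨stmt-QuantumFields-27930⟩, leaf FH-s of the S₃ assembly, continued from ✓`…PortS1FHParamD`: §D the (1.4) fixed point REDUCED to the (1.3) scheme
(`X := W(H₀B′ + A₀)` solves `X = W(A₁ − GX)`, `A₁ = H₀B′`), so `A₀ = −G·D♯_G(H₀B′)` and `(G, H₀, B′) ↦ A₀(B′)` is ANALYTIC on the open box `‖G‖ < b`, `‖H₀‖ < b`,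
`‖B′‖ < ε₃` under R3⁺; §E the s-corollary for `A₀`; §F THE LEAF: for `fam : DecoupledOps`, `(s, B′) ↦ hkFunctional (fam.fhOpsAt C W s) (D s) (A0 s) B′` is
`DifferentiableOn ℂ` on `U ×ˢ ball 0 ε₃` from the three (B-op) rows, (B-C)⁺, (B-W)⁺, the smallness rows and ANY solution families; §G the same at the port's names
(`sPolydisc`, `fam.Bounds κ₁ B₀`).  JOINT differentiability in `(s, B′)` is what (1.23)'s iterated Cauchy formula consumes; Hartogs-type upgrades are avoided because
`s` enters only through `s ↦ (H, H₀, G)(s)`.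
[cite: Balaban1988RG2Cluster, p.3 L1–5, (1.4) p.2, (1.15)–(1.18) p.6, p.5 L−3–p.6 L1, (1.23) p.7]
-/

namespace Summit.QuantumFields.YangMills.Theorems.BalabanUVNodesPortS1.FHParam

open Literature.MathematicalPhysics.QuantumFieldTheory.Balaban1983to89
open Literature.MathematicalPhysics.QuantumFieldTheory.Balaban1983to89.B13Contraction113 (QuadAnalytic)
open Summit.QuantumFields.YangMills.Theorems.BalabanUVNodesPortS1.FHInterface

/-! ## §D  The (1.4) fixed point `A₀` as an analytic functional of `(G, H₀, B′)` — REDUCED TO §B: `X := W(H₀B′ + A₀)` solves `X = W(A₁ − GX)`, `A₁ = H₀B′` -/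

section fh2

variable {𝔄 𝔅 𝔜 : Type*} [NormedAddCommGroup 𝔄] [NormedSpace ℂ 𝔄] [NormedAddCommGroup 𝔅] [NormedSpace ℂ 𝔅]
  [NormedAddCommGroup 𝔜] [NormedSpace ℂ 𝔜]
  {W : 𝔄 → 𝔜} {C₄ R_W b ε₃ : ℝ}

omit [NormedSpace ℂ 𝔄] in
/-- Smallness bookkeeping ([II] p.6: «B₀e^{16κ₁}ε₃ + 4C₄(B₀e^{16κ₁})³ε₃² ≦ 2B₀e^{16κ₁}ε₃»): under `9C₄b²ε₃ < 1`, `‖A₁‖ < bε₃` and `‖Y‖ ≤ 4C₄b³ε₃²`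
give `‖A₁ + Y‖ < 2bε₃`. [cite: Balaban1988RG2Cluster, (1.15) p.6 (bookkeeping)] -/
theorem norm_add_lt_two (hC₄ : 0 ≤ C₄) (hb : 0 ≤ b) (hq : 9 * C₄ * b ^ 2 * ε₃ < 1) {A₁ Y : 𝔄} (hA₁ : ‖A₁‖ < b * ε₃)
    (hY : ‖Y‖ ≤ 4 * C₄ * b ^ 3 * ε₃ ^ 2) : ‖A₁ + Y‖ < 2 * (b * ε₃) := by
  have hε : 0 < b * ε₃ := lt_of_le_of_lt (norm_nonneg _) hA₁
  have hbpos : 0 < b := lt_of_le_of_ne hb (by rintro rfl; simp at hε)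
  have hε₃ : 0 < ε₃ := by nlinarith [hε, hbpos]
  have hx : 0 ≤ C₄ * b ^ 2 * ε₃ := by positivity
  have h2 : 4 * C₄ * b ^ 2 * ε₃ ≤ 1 := by linarith
  have h1 : 4 * C₄ * b ^ 3 * ε₃ ^ 2 ≤ b * ε₃ := by
    have : 4 * C₄ * b ^ 3 * ε₃ ^ 2 = (4 * C₄ * b ^ 2 * ε₃) * (b * ε₃) := by ring
    rw [this]
    calc (4 * C₄ * b ^ 2 * ε₃) * (b * ε₃) ≤ 1 * (b * ε₃) := mul_le_mul_of_nonneg_right h2 hε.le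
      _ = b * ε₃ := one_mul _
  calc ‖A₁ + Y‖ ≤ ‖A₁‖ + ‖Y‖ := norm_add_le _ _
    _ < b * ε₃ + b * ε₃ := add_lt_add_of_lt_of_le hA₁ (hY.trans h1)
    _ = 2 * (b * ε₃) := by ring

/-- `‖K‖ < b`, `‖B′‖ < ε₃` ⇒ `‖KB′‖ < bε₃` (bookkeeping). [folklore] -/
theorem norm_apply_lt {K : 𝔅 →L[ℂ] 𝔄} (hK : ‖K‖ < b) {B' : 𝔅} (hB' : ‖B'‖ < ε₃) : ‖K B'‖ < b * ε₃ :=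
  (K.le_opNorm B').trans_lt (mul_lt_mul'' hK hB' (norm_nonneg _) (norm_nonneg _))

/-- **(1.4) ⇒ a (1.3)-type fixed point.**  If `Y + G W(A₁ + Y) = 0` with `‖A₁‖ < bε₃`, `‖Y‖ ≤ 4C₄b³ε₃²`, then `X := W(A₁ + Y)` lies in the closed ball `4C₄(bε₃)²`
and solves `X = W(A₁ − GX)` — the (1.3)-scheme for the data `(C, T, ε, C₂) := (W, G, bε₃, C₄)` (cf. ✓`B13Contraction113.fixedPoint_115`'s substitution). [folklore]
[cite: Balaban1988RG2Cluster, (1.4) p.2, (1.15)–(1.16) p.6] -/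
theorem fh2_to_fh1 (hWq : ∀ Z : 𝔄, ‖Z‖ < R_W → ‖W Z‖ ≤ C₄ * ‖Z‖ ^ 2) (hC₄ : 0 ≤ C₄) (hb : 0 ≤ b)
    (hq : 9 * C₄ * b ^ 2 * ε₃ < 1) (hRW : 3 * (b * ε₃) ≤ R_W) {G : 𝔜 →L[ℂ] 𝔄} {A₁ Y : 𝔄} (hA₁ : ‖A₁‖ < b * ε₃)
    (hY : ‖Y‖ ≤ 4 * C₄ * b ^ 3 * ε₃ ^ 2) (hfix : Y + G (W (A₁ + Y)) = 0) :
    W (A₁ + Y) ∈ closedBall (0:𝔜) (4 * C₄ * (b * ε₃) ^ 2) ∧ W (A₁ - G (W (A₁ + Y))) = W (A₁ + Y) := by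
  have h2 := norm_add_lt_two hC₄ hb hq hA₁ hY
  have hε : 0 < b * ε₃ := lt_of_le_of_lt (norm_nonneg _) hA₁
  have hGW : G (W (A₁ + Y)) = -Y := by
    rw [eq_neg_iff_add_eq_zero, add_comm]; exact hfix
  refine ⟨?_, ?_⟩
  · rw [mem_closedBall_zero_iff]
    have hR : ‖A₁ + Y‖ < R_W := by linarith
    calc ‖W (A₁ + Y)‖ ≤ C₄ * ‖A₁ + Y‖ ^ 2 := hWq _ hR
      _ ≤ C₄ * (2 * (b * ε₃)) ^ 2 := by gcongr
      _ = 4 * C₄ * (b * ε₃) ^ 2 := by ring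
  · rw [hGW, sub_neg_eq_add]

/-- The contraction row in the shape the tree's (1.3)-lemmas take it for the data `(W, G, bε₃, C₄, b)`. [folklore] -/
theorem hq_fh2 (hq : 9 * C₄ * b ^ 2 * ε₃ < 1) : 9 * C₄ * b * (b * ε₃) < 1 := by
  have : 9 * C₄ * b * (b * ε₃) = 9 * C₄ * b ^ 2 * ε₃ := by ring
  rw [this]; exact hq

variable [CompleteSpace 𝔜]

/-- **Uniqueness ⇒ the (1.4)-solution is `−G·D♯_G(A₁)`** for ANY (1.3)-type family `D♯` for the data `(W, ·)` on `‖T‖ < b`, `‖A₁‖ < bε₃`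
(✓`B12Lineariz267.eq_Dt_of_fixedPt`). [folklore] -/
theorem fh2_eq_neg_apply (hW : QuadAnalytic W C₄ R_W) (hC₄ : 0 ≤ C₄) (hb : 0 ≤ b) (hq : 9 * C₄ * b ^ 2 * ε₃ < 1)
    (hRW : 3 * (b * ε₃) ≤ R_W) {Dsh : (𝔜 →L[ℂ] 𝔄) → 𝔄 → 𝔜}
    (hDball : ∀ T : 𝔜 →L[ℂ] 𝔄, ‖T‖ < b → ∀ A₁ : 𝔄, ‖A₁‖ < b * ε₃ → Dsh T A₁ ∈ closedBall (0:𝔜) (4 * C₄ * (b * ε₃) ^ 2))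
    (hDfix : ∀ T : 𝔜 →L[ℂ] 𝔄, ‖T‖ < b → ∀ A₁ : 𝔄, ‖A₁‖ < b * ε₃ → W (A₁ - T (Dsh T A₁)) = Dsh T A₁)
    {G : 𝔜 →L[ℂ] 𝔄} (hG : ‖G‖ < b) {A₁ Y : 𝔄} (hA₁ : ‖A₁‖ < b * ε₃) (hY : ‖Y‖ ≤ 4 * C₄ * b ^ 3 * ε₃ ^ 2)
    (hfix : Y + G (W (A₁ + Y)) = 0) : Y = -(G (Dsh G A₁)) := by
  obtain ⟨hXball, hXfix⟩ := fh2_to_fh1 hW.quad hC₄ hb hq hRW hA₁ hY hfix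
  have hX : W (A₁ + Y) = Dsh G A₁ :=
    B12Lineariz267.eq_Dt_of_fixedPt (hop := (G : 𝔜 →ₗ[ℂ] 𝔄)) hW hC₄ hb (hHop_of_norm_le hG.le) (hq_fh2 hq) hRW
      (hDball G hG) (hDfix G hG) hA₁ hXball hXfix
  have hGW : G (W (A₁ + Y)) = -Y := by
    rw [eq_neg_iff_add_eq_zero, add_comm]; exact hfix
  rw [← hX, hGW, neg_neg]

variable [CompleteSpace 𝔄]

/-- **The canonical expression `(G, K, B′) ↦ −G·D♯_G(KB′)` is complex-ANALYTIC** at every point of the open box `‖G‖ < b`, `‖K‖ < b`, `‖B′‖ < ε₃` (§B for the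
data `(W, ·)` composed with the continuous bilinear maps `(K, B′) ↦ KB′`, `(G, X) ↦ GX`). [folklore] -/
theorem analyticAt_A0canon (hW : QuadAnalytic W C₄ R_W) (hWa : AnalyticOnNhd ℂ W {Z : 𝔄 | ‖Z‖ < R_W}) (hC₄ : 0 ≤ C₄) (hb : 0 ≤ b)
    (hq : 9 * C₄ * b ^ 2 * ε₃ < 1) (hRW : 3 * (b * ε₃) ≤ R_W) {Dsh : (𝔜 →L[ℂ] 𝔄) → 𝔄 → 𝔜}
    (hDball : ∀ T : 𝔜 →L[ℂ] 𝔄, ‖T‖ < b → ∀ A₁ : 𝔄, ‖A₁‖ < b * ε₃ → Dsh T A₁ ∈ closedBall (0:𝔜) (4 * C₄ * (b * ε₃) ^ 2))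
    (hDfix : ∀ T : 𝔜 →L[ℂ] 𝔄, ‖T‖ < b → ∀ A₁ : 𝔄, ‖A₁‖ < b * ε₃ → W (A₁ - T (Dsh T A₁)) = Dsh T A₁)
    {G₀ : 𝔜 →L[ℂ] 𝔄} (hG₀ : ‖G₀‖ < b) {K₀ : 𝔅 →L[ℂ] 𝔄} (hK₀ : ‖K₀‖ < b) {B₀ : 𝔅} (hB₀ : ‖B₀‖ < ε₃) :
    AnalyticAt ℂ (fun p : (𝔜 →L[ℂ] 𝔄) × ((𝔅 →L[ℂ] 𝔄) × 𝔅) => -(p.1 (Dsh p.1 (p.2.1 p.2.2)))) (G₀, (K₀, B₀)) := by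
  have hA₁ : ‖K₀ B₀‖ < b * ε₃ := norm_apply_lt hK₀ hB₀
  have hD : AnalyticAt ℂ (fun r : (𝔜 →L[ℂ] 𝔄) × 𝔄 => Dsh r.1 r.2) (G₀, K₀ B₀) :=
    analyticAt_DT hW hWa hC₄ hb (hq_fh2 hq) hRW hDball hDfix hG₀ hA₁
  have h21 : AnalyticAt ℂ (fun p : (𝔜 →L[ℂ] 𝔄) × ((𝔅 →L[ℂ] 𝔄) × 𝔅) => p.2.1) (G₀, (K₀, B₀)) := analyticAt_fst.comp analyticAt_snd
  have h22 : AnalyticAt ℂ (fun p : (𝔜 →L[ℂ] 𝔄) × ((𝔅 →L[ℂ] 𝔄) × 𝔅) => p.2.2) (G₀, (K₀, B₀)) := analyticAt_snd.comp analyticAt_snd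
  have hKB : AnalyticAt ℂ (fun p : (𝔜 →L[ℂ] 𝔄) × ((𝔅 →L[ℂ] 𝔄) × 𝔅) => p.2.1 p.2.2) (G₀, (K₀, B₀)) := by
    have hbl := (ContinuousLinearMap.id ℂ (𝔅 →L[ℂ] 𝔄)).analyticAt_bilinear (K₀, B₀)
    exact hbl.comp₂ h21 h22
  have hr : AnalyticAt ℂ (fun p : (𝔜 →L[ℂ] 𝔄) × ((𝔅 →L[ℂ] 𝔄) × 𝔅) => Dsh p.1 (p.2.1 p.2.2)) (G₀, (K₀, B₀)) :=
    hD.comp₂ analyticAt_fst hKB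
  have hGX : AnalyticAt ℂ (fun p : (𝔜 →L[ℂ] 𝔄) × ((𝔅 →L[ℂ] 𝔄) × 𝔅) => p.1 (Dsh p.1 (p.2.1 p.2.2))) (G₀, (K₀, B₀)) := by
    have hbl := (ContinuousLinearMap.id ℂ (𝔜 →L[ℂ] 𝔄)).analyticAt_bilinear (G₀, Dsh G₀ (K₀ B₀))
    exact hbl.comp₂ analyticAt_fst hr
  exact hGX.neg

/-- **F_H-s, operator form for `A₀`: `(G, H₀, B′) ↦ A₀(B′)` is complex-ANALYTIC** on the open box `‖G‖ < b`, `‖H₀‖ < b`, `‖B′‖ < ε₃` for ANY family of solutions of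
(1.4) with `‖A₀‖ ≤ 4C₄b³ε₃²`, under R3⁺ `9C₄b²ε₃ < 1`, `3bε₃ ≤ R_W`, `W` analytic on `‖Z‖ < R_W` ([II] p.3 L3–5 for `A₀`: identification with the canonical expression by
`fh2_eq_neg_apply`, analyticity by `analyticAt_A0canon`). [folklore] [cite: Balaban1988RG2Cluster, p.3 L1–5, (1.15)–(1.16) p.6] -/
theorem analyticAt_A0 (hW : QuadAnalytic W C₄ R_W) (hWa : AnalyticOnNhd ℂ W {Z : 𝔄 | ‖Z‖ < R_W}) (hC₄ : 0 ≤ C₄) (hb : 0 ≤ b)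
    (hq : 9 * C₄ * b ^ 2 * ε₃ < 1) (hRW : 3 * (b * ε₃) ≤ R_W) {A0 : (𝔜 →L[ℂ] 𝔄) → (𝔅 →L[ℂ] 𝔄) → 𝔅 → 𝔄}
    (hA0ball : ∀ G : 𝔜 →L[ℂ] 𝔄, ‖G‖ < b → ∀ K : 𝔅 →L[ℂ] 𝔄, ‖K‖ < b → ∀ B' : 𝔅, ‖B'‖ < ε₃ → ‖A0 G K B'‖ ≤ 4 * C₄ * b ^ 3 * ε₃ ^ 2)
    (hA0fix : ∀ G : 𝔜 →L[ℂ] 𝔄, ‖G‖ < b → ∀ K : 𝔅 →L[ℂ] 𝔄, ‖K‖ < b → ∀ B' : 𝔅, ‖B'‖ < ε₃ → A0 G K B' + G (W (K B' + A0 G K B')) = 0)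
    {G₀ : 𝔜 →L[ℂ] 𝔄} (hG₀ : ‖G₀‖ < b) {K₀ : 𝔅 →L[ℂ] 𝔄} (hK₀ : ‖K₀‖ < b) {B₀ : 𝔅} (hB₀ : ‖B₀‖ < ε₃) :
    AnalyticAt ℂ (fun p : (𝔜 →L[ℂ] 𝔄) × ((𝔅 →L[ℂ] 𝔄) × 𝔅) => A0 p.1 p.2.1 p.2.2) (G₀, (K₀, B₀)) := by
  classical
  have hex : ∀ T : 𝔜 →L[ℂ] 𝔄, ‖T‖ < b → ∃ Dt : 𝔄 → 𝔜, ∀ A₁ : 𝔄, ‖A₁‖ < b * ε₃ →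
      Dt A₁ ∈ closedBall (0:𝔜) (4 * C₄ * (b * ε₃) ^ 2) ∧ W (A₁ - (T : 𝔜 →ₗ[ℂ] 𝔄) (Dt A₁)) = Dt A₁ := fun T hT =>
    B12Lineariz267.exists_Dt (hop := (T : 𝔜 →ₗ[ℂ] 𝔄)) hW hC₄ hb (hHop_of_norm_le hT.le) (hq_fh2 hq) hRW
  let Dsh : (𝔜 →L[ℂ] 𝔄) → 𝔄 → 𝔜 := fun T => if hT : ‖T‖ < b then Classical.choose (hex T hT) else fun _ => 0
  have hDsh : ∀ T : 𝔜 →L[ℂ] 𝔄, ∀ hT : ‖T‖ < b, ∀ A₁ : 𝔄, ‖A₁‖ < b * ε₃ →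
      Dsh T A₁ ∈ closedBall (0:𝔜) (4 * C₄ * (b * ε₃) ^ 2) ∧ W (A₁ - T (Dsh T A₁)) = Dsh T A₁ := by
    intro T hT A₁ hA₁
    simp only [Dsh, dif_pos hT]
    exact Classical.choose_spec (hex T hT) A₁ hA₁
  have hcanon := analyticAt_A0canon (𝔅 := 𝔅) hW hWa hC₄ hb hq hRW (fun T hT A₁ hA₁ => (hDsh T hT A₁ hA₁).1)
    (fun T hT A₁ hA₁ => (hDsh T hT A₁ hA₁).2) hG₀ hK₀ hB₀
  refine hcanon.congr ?_
  have hnear : ∀ᶠ p in 𝓝 ((G₀, (K₀, B₀)) : (𝔜 →L[ℂ] 𝔄) × ((𝔅 →L[ℂ] 𝔄) × 𝔅)), ‖p.1‖ < b ∧ ‖p.2.1‖ < b ∧ ‖p.2.2‖ < ε₃ := by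
    have h1 : IsOpen {p : (𝔜 →L[ℂ] 𝔄) × ((𝔅 →L[ℂ] 𝔄) × 𝔅) | ‖p.1‖ < b ∧ ‖p.2.1‖ < b ∧ ‖p.2.2‖ < ε₃} :=
      (isOpen_lt (continuous_fst.norm) continuous_const).inter
        ((isOpen_lt ((continuous_fst.comp continuous_snd).norm) continuous_const).inter
          (isOpen_lt ((continuous_snd.comp continuous_snd).norm) continuous_const))
    exact h1.mem_nhds ⟨hG₀, hK₀, hB₀⟩
  filter_upwards [hnear] with p hp
  exact (fh2_eq_neg_apply hW hC₄ hb hq hRW (fun T hT A₁ hA₁ => (hDsh T hT A₁ hA₁).1) (fun T hT A₁ hA₁ => (hDsh T hT A₁ hA₁).2)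
    hp.1 (norm_apply_lt hp.2.1 hp.2.2) (hA0ball p.1 hp.1 p.2.1 hp.2.1 p.2.2 hp.2.2) (hA0fix p.1 hp.1 p.2.1 hp.2.1 p.2.2 hp.2.2)).symm

end fh2

/-! ## §E  F_H-s for `A₀`: the s-COROLLARY (families `G(s)`, `H₀(s)` ℂ-differentiable in `s`, bounded by `b₀ < b`) -/

section sparamA0

variable {𝔄 𝔅 𝔜 : Type*} [NormedAddCommGroup 𝔄] [NormedSpace ℂ 𝔄] [CompleteSpace 𝔄] [NormedAddCommGroup 𝔅] [NormedSpace ℂ 𝔅]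
  [NormedAddCommGroup 𝔜] [NormedSpace ℂ 𝔜] [CompleteSpace 𝔜]
  {σ : Type*} [Fintype σ] {W : 𝔄 → 𝔜} {C₄ R_W b₀ b ε₃ : ℝ} {Gs : (σ → ℂ) → (𝔜 →L[ℂ] 𝔄)} {Ks : (σ → ℂ) → (𝔅 →L[ℂ] 𝔄)}
  {U : Set (σ → ℂ)} {A0 : (σ → ℂ) → 𝔅 → 𝔄}

/-- **F_H-s (the `A₀` half): `(s, B′) ↦ A₀,s(B′)` is ℂ-differentiable on `U ×ˢ {‖B′‖ < ε₃}`** for ANY family `A₀,s` of solutions of (1.4) with the operators `G(s)`,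
`H₀(s)` and `‖A₀,s(B′)‖ ≤ 4C₄b³ε₃²`, whenever `s ↦ G(s)`, `s ↦ H₀(s)` are ℂ-differentiable on `U` and bounded there by `b₀ < b` (the (B-op) rows of ✓`DecoupledOps.Bounds`
with `b₀ = B₀e^{16κ₁}`; the smallness rows R3⁺ `9C₄b²ε₃ < 1`, `3bε₃ ≤ R_W` at any `b > b₀` — the assembler's choice of `ε₃`). [folklore]
[cite: Balaban1988RG2Cluster, p.3 L1–5, (1.15)–(1.16) p.6, p.5 L−3] -/
theorem differentiableOn_A0_sparam (hW : QuadAnalytic W C₄ R_W) (hWa : AnalyticOnNhd ℂ W {Z : 𝔄 | ‖Z‖ < R_W}) (hC₄ : 0 ≤ C₄)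
    (hb₀ : 0 ≤ b₀) (hb₀b : b₀ < b) (hq : 9 * C₄ * b ^ 2 * ε₃ < 1) (hRW : 3 * (b * ε₃) ≤ R_W)
    (hGd : DifferentiableOn ℂ Gs U) (hGb : ∀ s ∈ U, ‖Gs s‖ ≤ b₀) (hKd : DifferentiableOn ℂ Ks U) (hKb : ∀ s ∈ U, ‖Ks s‖ ≤ b₀)
    (hA0ball : ∀ s ∈ U, ∀ B' : 𝔅, ‖B'‖ < ε₃ → ‖A0 s B'‖ ≤ 4 * C₄ * b ^ 3 * ε₃ ^ 2)
    (hA0fix : ∀ s ∈ U, ∀ B' : 𝔅, ‖B'‖ < ε₃ → A0 s B' + Gs s (W (Ks s B' + A0 s B')) = 0) :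
    DifferentiableOn ℂ (fun q : (σ → ℂ) × 𝔅 => A0 q.1 q.2) (U ×ˢ ball (0:𝔅) ε₃) := by
  classical
  have hb : 0 ≤ b := hb₀.trans hb₀b.le
  have hex : ∀ T : 𝔜 →L[ℂ] 𝔄, ‖T‖ < b → ∃ Dt : 𝔄 → 𝔜, ∀ A₁ : 𝔄, ‖A₁‖ < b * ε₃ →
      Dt A₁ ∈ closedBall (0:𝔜) (4 * C₄ * (b * ε₃) ^ 2) ∧ W (A₁ - (T : 𝔜 →ₗ[ℂ] 𝔄) (Dt A₁)) = Dt A₁ := fun T hT =>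
    B12Lineariz267.exists_Dt (hop := (T : 𝔜 →ₗ[ℂ] 𝔄)) hW hC₄ hb (hHop_of_norm_le hT.le) (hq_fh2 hq) hRW
  let Dsh : (𝔜 →L[ℂ] 𝔄) → 𝔄 → 𝔜 := fun T => if hT : ‖T‖ < b then Classical.choose (hex T hT) else fun _ => 0
  have hDsh : ∀ T : 𝔜 →L[ℂ] 𝔄, ∀ hT : ‖T‖ < b, ∀ A₁ : 𝔄, ‖A₁‖ < b * ε₃ →
      Dsh T A₁ ∈ closedBall (0:𝔜) (4 * C₄ * (b * ε₃) ^ 2) ∧ W (A₁ - T (Dsh T A₁)) = Dsh T A₁ := by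
    intro T hT A₁ hA₁
    simp only [Dsh, dif_pos hT]
    exact Classical.choose_spec (hex T hT) A₁ hA₁
  have hident : ∀ q ∈ U ×ˢ ball (0:𝔅) ε₃, A0 q.1 q.2 = -(Gs q.1 (Dsh (Gs q.1) (Ks q.1 q.2))) := by
    rintro ⟨s, B'⟩ ⟨hs, hB'⟩
    rw [mem_ball_zero_iff] at hB'
    have hG : ‖Gs s‖ < b := (hGb s hs).trans_lt hb₀b
    have hK : ‖Ks s‖ < b := (hKb s hs).trans_lt hb₀b
    exact fh2_eq_neg_apply hW hC₄ hb hq hRW (fun T hT A₁ hA₁ => (hDsh T hT A₁ hA₁).1) (fun T hT A₁ hA₁ => (hDsh T hT A₁ hA₁).2)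
      hG (norm_apply_lt hK hB') (hA0ball s hs B' hB') (hA0fix s hs B' hB')
  rintro ⟨s, B'⟩ ⟨hs, hB'⟩
  have hB'' : ‖B'‖ < ε₃ := mem_ball_zero_iff.mp hB'
  have hG : ‖Gs s‖ < b := (hGb s hs).trans_lt hb₀b
  have hK : ‖Ks s‖ < b := (hKb s hs).trans_lt hb₀b
  have hcanon := analyticAt_A0canon (𝔅 := 𝔅) hW hWa hC₄ hb hq hRW (fun T hT A₁ hA₁ => (hDsh T hT A₁ hA₁).1)
    (fun T hT A₁ hA₁ => (hDsh T hT A₁ hA₁).2) hG hK hB''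
  have hre : DifferentiableWithinAt ℂ (fun q : (σ → ℂ) × 𝔅 => (Gs q.1, (Ks q.1, q.2))) (U ×ˢ ball (0:𝔅) ε₃) (s, B') := by
    have h1 : DifferentiableWithinAt ℂ (fun q : (σ → ℂ) × 𝔅 => Gs q.1) (U ×ˢ ball (0:𝔅) ε₃) (s, B') :=
      (hGd s hs).comp (s, B') differentiableWithinAt_fst (fun q hqU => hqU.1)
    have h2 : DifferentiableWithinAt ℂ (fun q : (σ → ℂ) × 𝔅 => Ks q.1) (U ×ˢ ball (0:𝔅) ε₃) (s, B') :=
      (hKd s hs).comp (s, B') differentiableWithinAt_fst (fun q hqU => hqU.1)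
    exact h1.prodMk (h2.prodMk differentiableWithinAt_snd)
  have hcomp := hcanon.differentiableAt.comp_differentiableWithinAt (s, B') hre
  exact hcomp.congr (fun q hq => hident q hq) (hident (s, B') ⟨hs, hB'⟩)

end sparamA0

/-! ## §F  F_H-s for `H_k(s, B′)` itself: (1.17) is ℂ-differentiable in `(s, B′)` — the leaf, in the interface's own names -/

section sparamHk

variable {𝔄 𝔛 𝔅 𝔜 : Type*} [NormedAddCommGroup 𝔄] [NormedSpace ℂ 𝔄] [CompleteSpace 𝔄] [NormedAddCommGroup 𝔛] [NormedSpace ℂ 𝔛] [CompleteSpace 𝔛]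
  [NormedAddCommGroup 𝔅] [NormedSpace ℂ 𝔅] [NormedAddCommGroup 𝔜] [NormedSpace ℂ 𝔜] [CompleteSpace 𝔜]
  {σ : Type*} [Fintype σ]

/-- **LEAF FH-s DISCHARGED (abstract): `(s, B′) ↦ H_k(s, B′)` of (1.17) is ℂ-DIFFERENTIABLE on `U ×ˢ {‖B′‖ < ε₃}`** for the decoupled data
`fam.fhOpsAt C W s` and ANY families `D s` (solutions of (1.3) on `‖A′‖ < ε₂` with `‖D s A′‖ ≤ 4C₂ε₂²`) and `A₀,s` (solutions of (1.4) on `‖B′‖ < ε₃` with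
`‖A₀,s B′‖ ≤ 4C₄b³ε₃²`) — e.g. the ones ✓-v25 `fh12_on_sPolydisc` produces at each `s` —, given: the three (B-op) rows of ✓`DecoupledOps.Bounds` on `U` (differentiable,
bounded by `b₀`), (B-C)⁺, (B-W)⁺, and the smallness rows at some `b > b₀`: R2⁺ `9C₂bε₂ < 1`, `3ε₂ ≤ R_C`, R3⁺ `9C₄b²ε₃ < 1`, `3bε₃ ≤ R_W`, R4 `2bε₃ ≤ ε₂`.
Composition of §C (for `D`, at the point `H₀(s)B′ + A₀,s(B′)`, which has norm `< 2bε₃ ≤ ε₂`) and §E (for `A₀`).  This is [II] p.5 L−3–p.6 «analytic function of the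
variables s(Y₀)» for `H(s(Y₀)), B′)`, in the port's ONE currency (`DifferentiableOn ℂ`, jointly in `(s, B′)`); what (1.23)'s iterated Cauchy formula (tree ✓`B13Sect1Arith.cauchyOp`)
consumes. [cite: Balaban1988RG2Cluster, (1.17)–(1.18) p.6, p.5 L−3–p.6 L1, (1.23) p.7] -/
theorem differentiableOn_hk_sparam (fam : DecoupledOps 𝔄 𝔛 𝔅 𝔜 σ) {C : 𝔄 → 𝔛} {W : 𝔄 → 𝔜}
    {C₂ C₄ R_C R_W b₀ b ε₂ ε₃ : ℝ} {U : Set (σ → ℂ)} {D : (σ → ℂ) → 𝔄 → 𝔛} {A0 : (σ → ℂ) → 𝔅 → 𝔄}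
    (hC : AnalyticOnNhd ℂ C {Z : 𝔄 | ‖Z‖ < R_C} ∧ ∀ Z : 𝔄, ‖Z‖ < R_C → ‖C Z‖ ≤ C₂ * ‖Z‖ ^ 2)
    (hW : AnalyticOnNhd ℂ W {Z : 𝔄 | ‖Z‖ < R_W} ∧ ∀ Z : 𝔄, ‖Z‖ < R_W → ‖W Z‖ ≤ C₄ * ‖Z‖ ^ 2)
    (hC₂ : 0 ≤ C₂) (hC₄ : 0 ≤ C₄) (hb₀ : 0 ≤ b₀) (hb₀b : b₀ < b)
    (hq₂ : 9 * C₂ * b * ε₂ < 1) (hRC : 3 * ε₂ ≤ R_C) (hq₃ : 9 * C₄ * b ^ 2 * ε₃ < 1) (hRW : 3 * (b * ε₃) ≤ R_W) (hR4 : 2 * (b * ε₃) ≤ ε₂)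
    (hH : DifferentiableOn ℂ fam.Hs U ∧ ∀ s ∈ U, ‖fam.Hs s‖ ≤ b₀) (hH₀ : DifferentiableOn ℂ fam.H₀s U ∧ ∀ s ∈ U, ‖fam.H₀s s‖ ≤ b₀)
    (hG : DifferentiableOn ℂ fam.Gs U ∧ ∀ s ∈ U, ‖fam.Gs s‖ ≤ b₀)
    (hD : ∀ s ∈ U, DSolves (fam.fhOpsAt C W s) ε₂ (D s) ∧ ∀ A' : 𝔄, ‖A'‖ < ε₂ → ‖D s A'‖ ≤ 4 * C₂ * ε₂ ^ 2)
    (hA0 : ∀ s ∈ U, A0Solves (fam.fhOpsAt C W s) ε₃ (A0 s) ∧ ∀ B' : 𝔅, ‖B'‖ < ε₃ → ‖A0 s B'‖ ≤ 4 * C₄ * b ^ 3 * ε₃ ^ 2) :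
    DifferentiableOn ℂ (fun q : (σ → ℂ) × 𝔅 => hkFunctional (fam.fhOpsAt C W q.1) (D q.1) (A0 q.1) q.2) (U ×ˢ ball (0:𝔅) ε₃) := by
  have hb : 0 ≤ b := hb₀.trans hb₀b.le
  have hQC : QuadAnalytic C C₂ R_C := FHDischarge.quadAnalytic_of_analyticOnNhd hC.1 hC.2
  have hQW : QuadAnalytic W C₄ R_W := FHDischarge.quadAnalytic_of_analyticOnNhd hW.1 hW.2
  -- §C for `D` on `U × ball ε₂`
  have hDd : DifferentiableOn ℂ (fun r : (σ → ℂ) × 𝔄 => D r.1 r.2) (U ×ˢ ball (0:𝔄) ε₂) :=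
    differentiableOn_D_sparam hQC hC.1 hC₂ hb hq₂ hRC hH.1 (fun s hs => (hH.2 s hs).trans hb₀b.le)
      (fun s hs A' hA' => mem_closedBall_zero_iff.mpr ((hD s hs).2 A' hA'))
      (fun s hs A' hA' => ((hD s hs).1 A' hA').symm)
  -- §E for `A₀` on `U × ball ε₃`
  have hA0d : DifferentiableOn ℂ (fun q : (σ → ℂ) × 𝔅 => A0 q.1 q.2) (U ×ˢ ball (0:𝔅) ε₃) :=
    differentiableOn_A0_sparam hQW hW.1 hC₄ hb₀ hb₀b hq₃ hRW hG.1 hG.2 hH₀.1 hH₀.2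
      (fun s hs B' hB' => (hA0 s hs).2 B' hB') (fun s hs B' hB' => (hA0 s hs).1 B' hB')
  rintro ⟨s, B'⟩ ⟨hs, hB'⟩
  have hB'' : ‖B'‖ < ε₃ := mem_ball_zero_iff.mp hB'
  -- the pieces
  have t1 : DifferentiableWithinAt ℂ (fun q : (σ → ℂ) × 𝔅 => fam.H₀s q.1 q.2) (U ×ˢ ball (0:𝔅) ε₃) (s, B') :=
    ((hH₀.1 s hs).comp (s, B') differentiableWithinAt_fst (fun q hqU => hqU.1)).clm_apply differentiableWithinAt_snd
  have t2 : DifferentiableWithinAt ℂ (fun q : (σ → ℂ) × 𝔅 => A0 q.1 q.2) (U ×ˢ ball (0:𝔅) ε₃) (s, B') := hA0d (s, B') ⟨hs, hB'⟩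
  have t12 : DifferentiableWithinAt ℂ (fun q : (σ → ℂ) × 𝔅 => fam.H₀s q.1 q.2 + A0 q.1 q.2) (U ×ˢ ball (0:𝔅) ε₃) (s, B') :=
    t1.add t2
  have hmaps : MapsTo (fun q : (σ → ℂ) × 𝔅 => (q.1, fam.H₀s q.1 q.2 + A0 q.1 q.2)) (U ×ˢ ball (0:𝔅) ε₃) (U ×ˢ ball (0:𝔄) ε₂) := by
    rintro ⟨s', B''⟩ ⟨hs', hB2⟩
    rw [mem_ball_zero_iff] at hB2
    refine ⟨hs', mem_ball_zero_iff.mpr ?_⟩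
    have hK : ‖fam.H₀s s'‖ < b := (hH₀.2 s' hs').trans_lt hb₀b
    have h2 := norm_add_lt_two hC₄ hb hq₃ (norm_apply_lt hK hB2) ((hA0 s' hs').2 B'' hB2)
    exact lt_of_lt_of_le h2 hR4
  have t3 : DifferentiableWithinAt ℂ (fun q : (σ → ℂ) × 𝔅 => D q.1 (fam.H₀s q.1 q.2 + A0 q.1 q.2)) (U ×ˢ ball (0:𝔅) ε₃) (s, B') :=
    (hDd _ (hmaps ⟨hs, hB'⟩)).comp (s, B') (differentiableWithinAt_fst.prodMk t12) hmaps
  have t4 : DifferentiableWithinAt ℂ (fun q : (σ → ℂ) × 𝔅 => fam.Hs q.1 (D q.1 (fam.H₀s q.1 q.2 + A0 q.1 q.2))) (U ×ˢ ball (0:𝔅) ε₃) (s, B') :=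
    ((hH.1 s hs).comp (s, B') differentiableWithinAt_fst (fun q hqU => hqU.1)).clm_apply t3
  exact t12.sub t4

/-- **LEAF FH-s AT THE PORT'S NAMES** (`sPolydisc`, ✓`DecoupledOps.Bounds fam κ₁ B₀`): `(s, B′) ↦ H_k(s, B′)` is ℂ-differentiable on
`sPolydisc σ e^{κ₁} ×ˢ {‖B′‖ < ε₃}` for ANY solution families `D s`, `A₀,s` (as produced pointwise in `s` by ✓-J9 v25 `fh12_on_sPolydisc`), given (B-C)⁺, (B-W)⁺ and the
smallness rows R2⁺∕R3⁺∕R4 at any `b > B₀e^{16κ₁}` (assembler's choice of `ε₂, ε₃`).  One `exact` over `differentiableOn_hk_sparam`. [folklore]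
[cite: Balaban1988RG2Cluster, (1.11) p.5, p.5 L−3–p.6 L1, (1.17) p.6] -/
theorem differentiableOn_hk_on_sPolydisc (fam : DecoupledOps 𝔄 𝔛 𝔅 𝔜 σ) {C : 𝔄 → 𝔛} {W : 𝔄 → 𝔜}
    {κ₁ B₀ C₂ C₄ R_C R_W b ε₂ ε₃ : ℝ} {D : (σ → ℂ) → 𝔄 → 𝔛} {A0 : (σ → ℂ) → 𝔅 → 𝔄}
    (hfam : fam.Bounds κ₁ B₀) (hB₀ : 0 ≤ B₀) (hb : B₀ * Real.exp (16 * κ₁) < b)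
    (hC : AnalyticOnNhd ℂ C {Z : 𝔄 | ‖Z‖ < R_C} ∧ ∀ Z : 𝔄, ‖Z‖ < R_C → ‖C Z‖ ≤ C₂ * ‖Z‖ ^ 2)
    (hW : AnalyticOnNhd ℂ W {Z : 𝔄 | ‖Z‖ < R_W} ∧ ∀ Z : 𝔄, ‖Z‖ < R_W → ‖W Z‖ ≤ C₄ * ‖Z‖ ^ 2)
    (hC₂ : 0 ≤ C₂) (hC₄ : 0 ≤ C₄)
    (hq₂ : 9 * C₂ * b * ε₂ < 1) (hRC : 3 * ε₂ ≤ R_C) (hq₃ : 9 * C₄ * b ^ 2 * ε₃ < 1) (hRW : 3 * (b * ε₃) ≤ R_W) (hR4 : 2 * (b * ε₃) ≤ ε₂)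
    (hD : ∀ s ∈ sPolydisc σ (Real.exp κ₁), DSolves (fam.fhOpsAt C W s) ε₂ (D s) ∧ ∀ A' : 𝔄, ‖A'‖ < ε₂ → ‖D s A'‖ ≤ 4 * C₂ * ε₂ ^ 2)
    (hA0 : ∀ s ∈ sPolydisc σ (Real.exp κ₁), A0Solves (fam.fhOpsAt C W s) ε₃ (A0 s) ∧ ∀ B' : 𝔅, ‖B'‖ < ε₃ → ‖A0 s B'‖ ≤ 4 * C₄ * b ^ 3 * ε₃ ^ 2) :
    DifferentiableOn ℂ (fun q : (σ → ℂ) × 𝔅 => hkFunctional (fam.fhOpsAt C W q.1) (D q.1) (A0 q.1) q.2)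
      (sPolydisc σ (Real.exp κ₁) ×ˢ ball (0:𝔅) ε₃) :=
  differentiableOn_hk_sparam fam hC hW hC₂ hC₄ (by positivity) hb hq₂ hRC hq₃ hRW hR4 hfam.1 hfam.2.1 hfam.2.2 hD hA0

end sparamHk

end Summit.QuantumFields.YangMills.Theorems.BalabanUVNodesPortS1.FHParam
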